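import Literature.Geometry.GaugeTheory.SpinConnectionChartIndependence
import Literature.Geometry.Lorentzian.LeviCivitaProofs
import HarnessLib

/-!
# The trace of the Hessian over the frames of a `Spin^c` structure is a smooth global function

Topic `Literature/Geometry/GaugeTheory`; the regularity input for integrating the Bochner–Kato
identity (Morgan 1996, Cor. 5.2.2; Taubes 1994, §2): for a smooth function `f` on `X`, the trace
`Σ_k Hess f(e^{(i)}_k, e^{(i)}_k)` of its `g`-Hessian over the orthonormal frame of a chart `U_i`
(`= -Δ_g f`, Warner 6.1) is

* **independent of the chart** on overlaps (`sum_hessianAux_frame_eq_of_mem_overlap`: the Hessian is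
  a tensor, `hessian_apply_holds`, and the change of frames is orthogonal, `h hᵀ = 1`), and
* **smooth** on `U_i` (`contMDiffAt_hessianAux_frame`: derivatives of smooth functions along smooth
  fields, and `∇^{LC}_{e_k}e_l` is a smooth field);

hence `x ↦ Σ_k Hess f(e_k, e_k)(x)`, read in the chart chosen at each point (`indexAt`), is a smooth
function on `X` (`contMDiff_sum_hessianAux_frame_indexAt`).

PROVED, 0 named facts.

## References

* J. W. Morgan, *The Seiberg–Witten Equations and Applications to the Topology of Smooth
  Four-Manifolds* (1996), §3.1, Cor. 5.2.2. [MorganSWBook1996]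
* B. O'Neill, *Semi-Riemannian Geometry* (1983), Ch. 3, Def. 3.48–Lemma 3.49. [ONeill1983]
* F. W. Warner, *Foundations of Differentiable Manifolds and Lie Groups*, GTM 94 (1983), 6.1. [WarnerGTM94]
-/

noncomputable section

open scoped Manifold ContDiff Topology Bundle
open Set Function Filter Bundle
open Literature.Geometry.Lorentzian (PseudoRiemannianMetric)
open Literature.Topology.FourManifolds (SmoothOrientation)

namespace Literature.Geometry.GaugeTheory

namespace SpincStructure

variable {X : Type*} [TopologicalSpace X] [ChartedSpace (EuclideanSpace ℝ (Fin 4)) X] [IsManifold (𝓡 4) ∞ X]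
  {g : PseudoRiemannianMetric (𝓡 4) ∞ (EuclideanSpace ℝ (Fin 4)) (TangentSpace (𝓡 4) : X → Type _)}
  {o : SmoothOrientation (𝓡 4) X} {ι : Type*} (𝔰 : SpincStructure g o ι)

/-! ### Chart independence -/

/-- **The trace of a bilinear form over an orthonormal frame does not depend on the frame**: on
`U_i ∩ U_j`, `Σ_k B(e^{(j)}_k, e^{(j)}_k) = Σ_k B(e^{(i)}_k, e^{(i)}_k)` (`e^{(j)}_k = Σ_l h_{lk} e^{(i)}_l`
with `h hᵀ = 1`). [cite: MorganSWBook1996, §3.1] -/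
theorem sum_bilin_frame_eq_of_mem_overlap (i j : ι) {x : X} (hx : x ∈ 𝔰.baseSet i ∩ 𝔰.baseSet j)
    (B : LinearMap.BilinForm ℝ (TangentSpace (𝓡 4) x)) :
    ∑ k, B (𝔰.frame j k x) (𝔰.frame j k x) = ∑ k, B (𝔰.frame i k x) (𝔰.frame i k x) := by
  have hP := 𝔰.frameChange_mul_transpose_self i j hx
  have hlm : ∀ l m, ∑ k, 𝔰.frameChange i j x l k * 𝔰.frameChange i j x m k = if l = m then 1 else 0 := by
    intro l m
    have := congrFun (congrFun hP l) m
    simpa [Matrix.mul_apply, Matrix.one_apply] using this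
  calc ∑ k, B (𝔰.frame j k x) (𝔰.frame j k x)
      = ∑ k, ∑ l, ∑ m, 𝔰.frameChange i j x l k * 𝔰.frameChange i j x m k * B (𝔰.frame i m x) (𝔰.frame i l x) := by
        refine Finset.sum_congr rfl fun k _ ↦ ?_
        conv_lhs => rw [𝔰.frame_eq_sum_frameChange_smul i j hx k]
        simp only [map_sum, map_smul, LinearMap.sum_apply, LinearMap.smul_apply, smul_eq_mul, Finset.mul_sum]
        refine Finset.sum_congr rfl fun l _ ↦ Finset.sum_congr rfl fun m _ ↦ ?_
        ring
    _ = ∑ l, ∑ m, (∑ k, 𝔰.frameChange i j x l k * 𝔰.frameChange i j x m k) * B (𝔰.frame i m x) (𝔰.frame i l x) := by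
        rw [Finset.sum_comm]
        refine Finset.sum_congr rfl fun l _ ↦ ?_
        rw [Finset.sum_comm]
        refine Finset.sum_congr rfl fun m _ ↦ ?_
        rw [Finset.sum_mul]
    _ = ∑ k, B (𝔰.frame i k x) (𝔰.frame i k x) := by
        simp only [hlm, ite_mul, one_mul, zero_mul, Finset.sum_ite_eq, Finset.mem_univ, if_true]

variable [g.HasLeviCivita]

/-- **The trace of the Hessian over the frame is chart-independent**: for `f` of class `C²` at
`x ∈ U_i ∩ U_j`, `Σ_k Hess f(e^{(j)}_k, e^{(j)}_k)(x) = Σ_k Hess f(e^{(i)}_k, e^{(i)}_k)(x)` — the frame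
Hessian `X(Yf) - (∇_XY)f` is the tensor `Hess f` on differentiable fields (`hessian_apply_holds`).
[cite: ONeill1983, Ch. 3, Lemma 3.49] -/
theorem sum_hessianAux_frame_eq_of_mem_overlap {f : X → ℝ} {x : X} (hf : ContMDiffAt (𝓡 4) 𝓘(ℝ, ℝ) 2 f x)
    (i j : ι) (hx : x ∈ 𝔰.baseSet i ∩ 𝔰.baseSet j) :
    ∑ k, g.hessianAux f (𝔰.frame j k) (𝔰.frame j k) x = ∑ k, g.hessianAux f (𝔰.frame i k) (𝔰.frame i k) x := by
  have hi : ∀ k, g.hessianAux f (𝔰.frame i k) (𝔰.frame i k) x = g.hessian f x (𝔰.frame i k x) (𝔰.frame i k x) := fun k ↦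
    (PseudoRiemannianMetric.hessian_apply_holds (g := g) hf (𝔰.mdifferentiableAt_frame i k hx.1)
      (𝔰.mdifferentiableAt_frame i k hx.1)).symm
  have hj : ∀ k, g.hessianAux f (𝔰.frame j k) (𝔰.frame j k) x = g.hessian f x (𝔰.frame j k x) (𝔰.frame j k x) := fun k ↦
    (PseudoRiemannianMetric.hessian_apply_holds (g := g) hf (𝔰.mdifferentiableAt_frame j k hx.2)
      (𝔰.mdifferentiableAt_frame j k hx.2)).symm
  simp only [hi, hj]
  exact 𝔰.sum_bilin_frame_eq_of_mem_overlap i j hx (g.hessian f x)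

/-! ### Smoothness -/

/-- **`∇^{LC}_{W} e_l` is a smooth field at the points of the chart**, for a field `W` smooth at the
point (the Levi-Civita connection of a `C^∞` metric maps `C^∞` fields to `C^∞` sections of
`Hom(TX, TX)`, `contMDiffAt_inCoordinates_leviCivita`). [cite: MorganSWBook1996, §3.2] -/
theorem contMDiffAt_leviCivita_frame_apply (i : ι) (l : Fin 4) {x : X} (hx : x ∈ 𝔰.baseSet i)
    {W : Π y : X, TangentSpace (𝓡 4) y}
    (hW : ContMDiffAt (𝓡 4) ((𝓡 4).prod 𝓘(ℝ, EuclideanSpace ℝ (Fin 4))) ∞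
      (fun y : X ↦ TotalSpace.mk' (EuclideanSpace ℝ (Fin 4)) (E := (TangentSpace (𝓡 4) : X → Type _)) y (W y)) x) :
    ContMDiffAt (𝓡 4) ((𝓡 4).prod 𝓘(ℝ, EuclideanSpace ℝ (Fin 4))) ∞
      (fun y : X ↦ TotalSpace.mk' (EuclideanSpace ℝ (Fin 4)) (E := (TangentSpace (𝓡 4) : X → Type _)) y
        (g.leviCivita (𝔰.frame i l) y (W y))) x := by
  have htop : (((⊤ : ℕ∞) : ℕ∞ω) + 1) ≤ ∞ := by exact_mod_cast le_top
  have hLC : ContMDiffAt (𝓡 4) ((𝓡 4).prod 𝓘(ℝ, EuclideanSpace ℝ (Fin 4) →L[ℝ] EuclideanSpace ℝ (Fin 4))) ∞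
      (fun y ↦ TotalSpace.mk' (EuclideanSpace ℝ (Fin 4) →L[ℝ] EuclideanSpace ℝ (Fin 4))
        (E := fun y : X ↦ TangentSpace (𝓡 4) y →L[ℝ] TangentSpace (𝓡 4) y) y (g.leviCivita (𝔰.frame i l) y)) x := by
    rw [contMDiffAt_hom_bundle]
    exact ⟨contMDiffAt_id, g.contMDiffAt_inCoordinates_leviCivita ⊤ htop (𝔰.isOpen_baseSet i) hx
      ((𝔰.contMDiffOn_frame i l).of_le htop)⟩
  exact hLC.clm_bundle_apply hW

/-- **The frame Hessian `Hess f(e_k, e_l) = e_k(e_l f) - (∇_{e_k}e_l) f` is smooth at the points of the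
chart**, for smooth `f`. [cite: ONeill1983, Ch. 3, Def. 3.48] -/
theorem contMDiffAt_hessianAux_frame {f : X → ℝ} (hf : ContMDiff (𝓡 4) 𝓘(ℝ, ℝ) ∞ f) (i : ι) {x : X}
    (hx : x ∈ 𝔰.baseSet i) (k l : Fin 4) :
    ContMDiffAt (𝓡 4) 𝓘(ℝ, ℝ) ∞ (fun y ↦ g.hessianAux f (𝔰.frame i k) (𝔰.frame i l) y) x := by
  have hnhds := (𝔰.isOpen_baseSet i).mem_nhds hx
  -- `y ↦ e_l f (y)` is smooth near `x`
  have hu : ∀ y ∈ 𝔰.baseSet i, ContMDiffAt (𝓡 4) 𝓘(ℝ, ℝ) ∞ (fun z ↦ mvfderiv (𝓡 4) f z (𝔰.frame i l z)) y := by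
    intro y hy
    have hf' : ContMDiffAt (𝓡 4) 𝓘(ℝ, ℝ) (∞ + 1) f y := by simpa using hf y
    exact Literature.Geometry.Lorentzian.contMDiffAt_mvfderiv_apply_of_le hf' (𝔰.contMDiffAt_frame i l hy)
  have hu' : ContMDiffAt (𝓡 4) 𝓘(ℝ, ℝ) (∞ + 1) (fun z ↦ mvfderiv (𝓡 4) f z (𝔰.frame i l z)) x := by
    simpa using hu x hx
  have h1 : ContMDiffAt (𝓡 4) 𝓘(ℝ, ℝ) ∞
      (fun y ↦ mvfderiv (𝓡 4) (fun z ↦ mvfderiv (𝓡 4) f z (𝔰.frame i l z)) y (𝔰.frame i k y)) x :=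
    Literature.Geometry.Lorentzian.contMDiffAt_mvfderiv_apply_of_le hu' (𝔰.contMDiffAt_frame i k hx)
  have hf' : ContMDiffAt (𝓡 4) 𝓘(ℝ, ℝ) (∞ + 1) f x := by simpa using hf x
  have h2 : ContMDiffAt (𝓡 4) 𝓘(ℝ, ℝ) ∞
      (fun y ↦ mvfderiv (𝓡 4) f y (g.leviCivita (𝔰.frame i l) y (𝔰.frame i k y))) x :=
    Literature.Geometry.Lorentzian.contMDiffAt_mvfderiv_apply_of_le hf'
      (𝔰.contMDiffAt_leviCivita_frame_apply i l hx (𝔰.contMDiffAt_frame i k hx))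
  exact h1.sub h2

/-- The trace `Σ_k Hess f(e_k, e_k)` over the frame of `U_i` is smooth at the points of `U_i`. [folklore] -/
theorem contMDiffAt_sum_hessianAux_frame {f : X → ℝ} (hf : ContMDiff (𝓡 4) 𝓘(ℝ, ℝ) ∞ f) (i : ι) {x : X}
    (hx : x ∈ 𝔰.baseSet i) :
    ContMDiffAt (𝓡 4) 𝓘(ℝ, ℝ) ∞ (fun y ↦ ∑ k, g.hessianAux f (𝔰.frame i k) (𝔰.frame i k) y) x := by
  have h := ContMDiffAt.sum (t := Finset.univ) fun k _ ↦ 𝔰.contMDiffAt_hessianAux_frame hf i hx k k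
  simpa only [Finset.sum_apply] using h

/-- **`x ↦ Σ_k Hess f(e_k, e_k)(x)` (the chart read at each point) is a smooth function on `X`** for
smooth `f`: near `x` it agrees with the smooth trace over the frame of the fixed chart at `x`
(chart independence on the overlaps). [cite: WarnerGTM94, 6.1] -/
theorem contMDiff_sum_hessianAux_frame_indexAt {f : X → ℝ} (hf : ContMDiff (𝓡 4) 𝓘(ℝ, ℝ) ∞ f) :
    ContMDiff (𝓡 4) 𝓘(ℝ, ℝ) ∞ fun x ↦ ∑ k, g.hessianAux f (𝔰.frame (𝔰.indexAt x) k) (𝔰.frame (𝔰.indexAt x) k) x := by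
  intro x
  have hi := 𝔰.mem_baseSet_indexAt x
  refine (𝔰.contMDiffAt_sum_hessianAux_frame hf (𝔰.indexAt x) hi).congr_of_eventuallyEq ?_
  filter_upwards [(𝔰.isOpen_baseSet (𝔰.indexAt x)).mem_nhds hi] with y hy
  exact 𝔰.sum_hessianAux_frame_eq_of_mem_overlap ((hf y).of_le (inferInstance : ENat.LEInfty (2 : ℕ∞ω)).out)
    (𝔰.indexAt x) (𝔰.indexAt y) ⟨hy, 𝔰.mem_baseSet_indexAt y⟩

end SpincStructure

end Literature.Geometry.GaugeTheory

end
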